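import Summits.QuantumFields.YangMills.Theorems.BalabanUVNodesN21AtSpineCarriersSanity
import Summits.QuantumFields.YangMills.Theorems.BalabanUVNodesN21ClosenessJunction
import Literature.MathematicalPhysics.QuantumFieldTheory.Balaban1983to89.T4LipschitzCutoff

/-!
# YM-DAG node N21 (= NE7c) AT THE SPINE CARRIERS ON THE PROFILED ROAD (design (η), «Lipschitz cut-off profiles»): the
# K5 stub `YMDAG.UVSplit.S_N21 SRec` HOLDS for every carrier predicate reading two `T4LipschitzCutoff.LipSlotLedger`s +
# `SiblingSuppression` + a SUMMABLE two-run width `ρ` — the one NE7c road on which road II's missing `LevelGain` IS the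
# two-run width itself (no law of the tested variable, no (M1) `SlotAntiConcentration`); the width then specialised to
# N16's family `c₁·θ^j`, `θ⁶ = L⁻¹` of `…N21ClosenessJunction` §4 BY NAME

Track A of `YM-PLAN.md` (cell `pub-ymgap`, HUMAN RULING D-0062 ∕ D-0088), node **N21**; seat `pub-ymgap-dag-n21-e` (R141 (C) fan-out,
strategy s3 = ALTERNATIVE CURRENCY), generation 0, file 1.  Successor-by-topic of n21-a's K5 readings `BalabanUVNodesN21AtSpineCarriers`
(p417321: slot-ledger ∕ road I ∕ road II), `…Measure` (p419030 → p419827: END-I ∕ road (δ) ∕ the `SU(2)` seam) — which do NOT read the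
profiled road.  Kernel bookkeeping BY NAME over landed modules: 0 `def`, 0 `sorry`, standard axioms.  COUNT-NEUTRAL; `--supports`
the K3 item `SpineGivenEndpointR11` (stmt-QuantumFields-19676).

HONEST FRAMING.  NE7c (`T4IndicatorShell.ShellWeightBound`) is NOT PRINTED in [Bałaban 1983–89] (the manuscripts construct ONE run
with SHARP characteristic functions) and is NOT PROVED here.  Design (η) — Lipschitz profiles `χ_a(u∕θ)` of FIXED relative transition
width `κ_a` in place of the sharp small-∕large-field characteristic functions of the live window, IN BOTH RUNS — is a NON-PRINTED
PROCEDURE of the sibling cell `pub-balaban` (design (iii) of row T4-U5b.E2; admissible widths inside the printed threshold-ladder slack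
and the single-run re-read census are PRICED, not proved harmless, in `T4LipschitzCutoff` §4–§7; records `t4/T4-EST-U5bE2.md` §5–§9,
`t4/T4-EST-NE7c-P2.md` §6–§7).  On that road the per-slot mismatch of the two runs' profile factors is POINTWISE at most
`L_a·ρ(K − a) ×` the slot's own shell-restricted SIBLING (`T4LipschitzCutoff.minPiece_profile_mul_le_shell`), so the level gain road II
asks for (`T4ShellCount.LevelGain`, «THE MISSING INEQUALITY, TYPED») is MET by the two-run width `ρ` alone
(`T4LipschitzCutoff.levelGain_of_lipWeight`) — no density of any law, no anti-concentration (road I's wall (M1)), no integration by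
parts; in-edge N12 ([Balaban1989LargeFieldI] p. 193) is IDLE as a density source and alive only as the TEMPLATE of the sibling (rule
R-η-1: the sibling is the same-run lowered-threshold large-field term).  LOCATED CAVEATS, DISPLAYED AS BINDERS AND NEVER DISCHARGED HERE:
(a) the two `LipSlotLedger`s = [dict] (the run's expansion read as profile factors × a nonnegative remainder, `T4LipschitzLedger.TermRepr`;
its instantiation on Bałaban's (2.18)-terms is NODE O) + (η) itself; (b) `SiblingSuppression` = NE7b species (node N20's lane; NOT PRINTED as
a ratio statement) — or STRUCTURAL (`T4PatternLayer.siblingSuppression_layer₂`, the polarity-flip involution, constant `2`;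
`T4SiblingInsertion.siblingSuppression_of_towerBound`); (c) the width `ρ`, summable over levels = node N16 ∕ (F∞) (NE3 species, NOT
PRINTED; at run B's OWN fine test it is n21-a file 6's `((C_Q + K)∕ε)·θ^k` under `RegularSup`, `…N21FineTestJunction.relWidth_fineTest_of_n16`).
Nothing of Bałaban's is asserted; one finite four-torus programme at fixed `ε`; NOT continuum ∕ ℝ⁴ ∕ OS ∕ mass gap ∕ Clay.

CITATION HEADER (lean-in-tree rule 2026-08-18).  Everything BY NAME from the tree: `T4LipschitzCutoff` §3 (`LipSlotLedger`,
`SiblingSuppression`, `lipWeight`, `shellWeightBound_of_lipProfile`, `levelGain_of_lipWeight`, `tsum_weight_eq`, `lipWeight_nonneg`,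
`summable_lipWeight`), `T4ShellCount` (`AgeLedger`, `LevelGain`, `C0`), file 1 `BalabanUVNodesN21ShellWeightKnit` (`shellWeightBound_mono`,
`shellWeightBound_of_le_geometric`, `n21_knit_ages`), file 8 `…N21AtSpineCarriers` (`s_N21_of_agesReading`), file 3 `…N21ClosenessJunction`
§4 (`theta_lt_one`, `summable_width`), `T4ShellMeasureLevels.Toy` (the one-term toy carriers).  Context only (SHAPE, no sentence a hypothesis):
[Balaban1988Convergent] (2.17)∕(2.18) p. 257 (one small-field slot per cube; the density as a sum of terms); [Balaban1989LargeFieldI] p. 193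
«Thus 1 − χ_{k,Λ} is a large field function» (the sibling's template).

WHAT IS PROVED ([folklore] arithmetic on the landed structures).
§1 EXPLICIT CARRIERS.  `ageLedger_of_lipSlotLedger` (a Lipschitz slot ledger with sibling suppression IS road II's `AgeLedger` with the
  ratios `lipWeight Lχ S ρ`); `n21_knit_profiled` (two Lipschitz ledgers + sibling suppression ×2 + `Summable ρ` + union bounds ⇒
  `ShellWeightBound l₀ T A B shA shB Wsh` for ANY summable `Wsh ≥ Σ_{a≤N} n_a·lipWeight Lχ S ρ a K`); `lipWeight_le_geometric` ∕
  `bandWeight_le_geometric` ∕ `n21_knit_profiled_geometric` (width `c₁ϑ^j`, `0 < ϑ < 1` ⇒ the band weight lies under ONE geometric majorant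
  `(Σ_{a≤N} n_a L_a S_a c₁ ϑ^{−a})·ϑ^K` — the closed form U4′ reads); `n21_knit_ages_of_lipProfile` (+ `L_a·S_a ≤ e^{−p a}` ⇒ file 1's ROAD-II
  knit `n21_knit_ages` FIRES with `y = ρ`: road II closed FROM THE WIDTH).
§2 AT THE SPINE CARRIERS.  `s_N21_of_lipProfileReading` (`S_N21 SRec` for every (η)-reading predicate, ∃-closed over the auxiliary slot data
  exactly as file 8's readings); `s_N21_of_lipProfileReading_viaRoadII` (the same conclusion THROUGH file 8's road-II theorem
  `s_N21_of_agesReading`, at road II's weight `Σ_{a≤N} n_a e^{−p a} ρ(K − a)`).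
§3 THE WIDTH OF RECORD = N16's FAMILY.  `s_N21_of_lipProfileReading_n16Width` (`ρ := j ↦ c₁θ^j`, `2 ≤ L`, `0 < θ`, `θ⁶ = L⁻¹`, `0 ≤ c₁`:
  sign and summability DISCHARGED by file 3's `theta_lt_one` ∕ `summable_width`); `tsum_bandWeight_n16Width` (the price in closed form
  `Σ_K Wsh_K = C0(n, L·S)·c₁∕(1 − θ)`).
§4 VACUITY GUARD (audit A1–A6).  `lipSlotLedger_toy`, `siblingSuppression_toy`, `toy_bandWeight_eq`, `s_N21_fires_on_lipProfileReading`: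
  the §2 reading predicate is INHABITED at a non-degenerate bundle (nonempty classes, unit weights, shells `ϑ^K > 0`, record weight
  `ϑ^K > 0`) and `S_N21` fires on it by §2 — the binder is not void, the conclusion not the empty implication.
-/

set_option autoImplicit false

noncomputable section

open scoped BigOperators

namespace Summit.QuantumFields.YangMills.Theorems.N21AtSpineCarriersProfiled

open Literature.MathematicalPhysics.QuantumFieldTheory.Balaban1983to89
open T4IndicatorShell (ShellWeightBound)
open T4ShellCount (AgeLedger LevelGain C0)
open T4LipschitzCutoff (LipSlotLedger SiblingSuppression lipWeight shellWeightBound_of_lipProfile levelGain_of_lipWeight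
  tsum_weight_eq lipWeight_nonneg)
open YMDAG.UVSplit (SpineCarriers SpineRecordPred S_N21)
open N21AtSpineCarriers (s_N21_of_agesReading)
open N21ClosenessJunction (theta_lt_one summable_width)
open Finset

/-! ## §1 Explicit carriers: the profiled knit, its geometric majorant, and road II FROM THE WIDTH -/

section Explicit

variable {ι : Type*} {l₀ : ℝ} {T : ℕ → Finset ι} {A B X shA shB : ℕ → ℝ → ι → ℝ} {N : ℕ} {n : ℕ → ℕ}
  {shXs sibXs shAs sibAs shBs sibBs : (Σ _ : ℕ, ℕ) → ℕ → ℝ → ι → ℝ} {Lχ ρ S p : ℕ → ℝ}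

/-- **A LIPSCHITZ SLOT LEDGER WITH SIBLING SUPPRESSION IS ROAD II's AGE LEDGER**, with the per-age ratios
`x a K = lipWeight Lχ S ρ a K` (`= L_a S_a ρ(K − a)` on the band `a ≤ K`, `0` off it): `Σ_τ piece ≤ L_a ρ(K−a)·Σ_τ sibling ≤
L_a ρ(K−a) S_a·Σ_τ X` on the band (`piece_le_sib`, sibling suppression), `Σ_τ piece ≤ 0` off it (`piece_offband`). [folklore] -/
theorem ageLedger_of_lipSlotLedger (hL : LipSlotLedger l₀ T X N n shXs sibXs Lχ ρ)
    (hS : SiblingSuppression l₀ T X N n sibXs S) (hL0 : ∀ a ≤ N, 0 ≤ Lχ a) (hρ0 : ∀ j, 0 ≤ ρ j) :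
    AgeLedger l₀ T X N n shXs (lipWeight Lχ S ρ) where
  piece_nonneg := hL.piece_nonneg
  piece_le := hL.piece_le
  ratio σ hσ K t ht := by
    have ha : σ.1 ≤ N := mem_range_succ_iff.1 (mem_sigma.1 hσ).1
    unfold lipWeight
    split_ifs with hK
    · calc ∑ τ ∈ T K, shXs σ K t τ ≤ ∑ τ ∈ T K, Lχ σ.1 * ρ (K - σ.1) * sibXs σ K t τ :=
            sum_le_sum fun τ hτ => hL.piece_le_sib σ hσ K t ht hK τ hτ
        _ = Lχ σ.1 * ρ (K - σ.1) * ∑ τ ∈ T K, sibXs σ K t τ := by rw [mul_sum]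
        _ ≤ Lχ σ.1 * ρ (K - σ.1) * (S σ.1 * ∑ τ ∈ T K, X K t τ) :=
            mul_le_mul_of_nonneg_left (hS σ hσ K t ht) (mul_nonneg (hL0 _ ha) (hρ0 _))
        _ = Lχ σ.1 * S σ.1 * ρ (K - σ.1) * ∑ τ ∈ T K, X K t τ := by ring
    · rw [zero_mul]
      exact sum_nonpos fun τ hτ => hL.piece_offband σ hσ K t ht (not_le.1 hK) τ hτ

/-- **N21 KNIT, PROFILED ROAD (design (η)).**  At explicit term-class carriers `(l₀, T, A, B, shA, shB)`: [dict]+(η) = the two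
`LipSlotLedger`s (slots `⟨a, i⟩`, `a ≤ N`, `i < n a`; min-pieces `≤` the term, vanishing off the band, `≤ L_a ρ(K − a) ×` the slot's
sibling on it); NE7b species = `SiblingSuppression` with `S_a` in both runs; N16 = the width `ρ ≥ 0` SUMMABLE over levels; the union
bounds of the total shell parts by the slot pieces ⇒ `ShellWeightBound l₀ T A B shA shB Wsh` for EVERY summable weight slot `Wsh`
dominating the band weight `Σ_{a≤N} n_a·lipWeight Lχ S ρ a K` (`T4LipschitzCutoff.shellWeightBound_of_lipProfile` + file 1's
`shellWeightBound_mono` BY NAME).  NO anti-concentration binder, NO constant `D ≤ D̄`, NO rate `0 < ϑ < 1`.  CONDITIONAL on every displayed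
binder; NE7c NOT proved. [folklore] -/
theorem n21_knit_profiled (hLA : LipSlotLedger l₀ T A N n shAs sibAs Lχ ρ) (hLB : LipSlotLedger l₀ T B N n shBs sibBs Lχ ρ)
    (hSA : SiblingSuppression l₀ T A N n sibAs S) (hSB : SiblingSuppression l₀ T B N n sibBs S)
    (hL0 : ∀ a ≤ N, 0 ≤ Lχ a) (hS0 : ∀ a ≤ N, 0 ≤ S a) (hρ0 : ∀ j, 0 ≤ ρ j) (hρ : Summable ρ)
    (hA0 : ∀ K t, |t| ≤ l₀ → ∀ τ ∈ T K, 0 ≤ shA K t τ) (hAle : ∀ K t, |t| ≤ l₀ → ∀ τ ∈ T K, shA K t τ ≤ A K t τ)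
    (hAu : ∀ K t, |t| ≤ l₀ → ∀ τ ∈ T K,
      shA K t τ ≤ ∑ σ ∈ (range (N + 1)).sigma (fun a => range (n a)), shAs σ K t τ)
    (hB0 : ∀ K t, |t| ≤ l₀ → ∀ τ ∈ T K, 0 ≤ shB K t τ) (hBle : ∀ K t, |t| ≤ l₀ → ∀ τ ∈ T K, shB K t τ ≤ B K t τ)
    (hBu : ∀ K t, |t| ≤ l₀ → ∀ τ ∈ T K,
      shB K t τ ≤ ∑ σ ∈ (range (N + 1)).sigma (fun a => range (n a)), shBs σ K t τ)
    {Wsh : ℕ → ℝ} (hWsh : ∀ K, ∑ a ∈ range (N + 1), (n a : ℝ) * lipWeight Lχ S ρ a K ≤ Wsh K)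
    (hsum : Summable Wsh) : ShellWeightBound l₀ T A B shA shB Wsh :=
  shellWeightBound_mono (shellWeightBound_of_lipProfile hLA hLB hSA hSB hL0 hS0 hρ0 hρ hA0 hAle hAu hB0 hBle hBu) hWsh hsum

/-- At a GEOMETRIC width `ρ_j = c₁ϑ^j` (`0 ≤ c₁`, `0 < ϑ`; N16's shape) one age strip of the band weight lies under the geometric
majorant `(L_a S_a c₁ ϑ^{−a})·ϑ^K` (`ϑ^{K−a} = ϑ^K·ϑ^{−a}` on the band, `0 ≤` off it). [folklore] -/
theorem lipWeight_le_geometric {Lχ S : ℕ → ℝ} {c₁ ϑ : ℝ} (hL0 : ∀ a ≤ N, 0 ≤ Lχ a) (hS0 : ∀ a ≤ N, 0 ≤ S a)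
    (hc₁ : 0 ≤ c₁) (hϑ : 0 < ϑ) {a : ℕ} (ha : a ≤ N) (K : ℕ) :
    lipWeight Lχ S (fun j => c₁ * ϑ ^ j) a K ≤ (Lχ a * S a * c₁ * ϑ⁻¹ ^ a) * ϑ ^ K := by
  unfold lipWeight
  split_ifs with hK
  · dsimp only
    rw [pow_sub₀ _ hϑ.ne' hK, inv_pow]
    exact le_of_eq (by ring)
  · exact mul_nonneg (mul_nonneg (mul_nonneg (mul_nonneg (hL0 a ha) (hS0 a ha)) hc₁)
      (pow_nonneg (inv_nonneg.2 hϑ.le) a)) (pow_nonneg hϑ.le K)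

/-- … hence the whole band weight lies under ONE geometric majorant `(Σ_{a≤N} n_a L_a S_a c₁ ϑ^{−a})·ϑ^K` — the slot-ledger reading's
currency (file 8's `s_N21_of_slotLedgersReading`: `ω ≤ C·ϑ^K`). [folklore] -/
theorem bandWeight_le_geometric {Lχ S : ℕ → ℝ} {c₁ ϑ : ℝ} (hL0 : ∀ a ≤ N, 0 ≤ Lχ a) (hS0 : ∀ a ≤ N, 0 ≤ S a)
    (hc₁ : 0 ≤ c₁) (hϑ : 0 < ϑ) (K : ℕ) :
    ∑ a ∈ range (N + 1), (n a : ℝ) * lipWeight Lχ S (fun j => c₁ * ϑ ^ j) a K ≤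
      (∑ a ∈ range (N + 1), (n a : ℝ) * (Lχ a * S a * c₁ * ϑ⁻¹ ^ a)) * ϑ ^ K := by
  rw [sum_mul]
  refine sum_le_sum fun a ha => ?_
  rw [mul_assoc]
  exact mul_le_mul_of_nonneg_left (lipWeight_le_geometric hL0 hS0 hc₁ hϑ (mem_range_succ_iff.1 ha) K) (Nat.cast_nonneg _)

/-- **The profiled knit with the CLOSED-FORM geometric weight** `Wsh K = (Σ_{a≤N} n_a L_a S_a c₁ ϑ^{−a})·ϑ^K` at a geometric width
`ρ_j = c₁ϑ^j`, `0 < ϑ < 1` (file 1's `shellWeightBound_of_le_geometric`). [folklore] -/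
theorem n21_knit_profiled_geometric {c₁ ϑ : ℝ}
    (hLA : LipSlotLedger l₀ T A N n shAs sibAs Lχ (fun j => c₁ * ϑ ^ j))
    (hLB : LipSlotLedger l₀ T B N n shBs sibBs Lχ (fun j => c₁ * ϑ ^ j))
    (hSA : SiblingSuppression l₀ T A N n sibAs S) (hSB : SiblingSuppression l₀ T B N n sibBs S)
    (hL0 : ∀ a ≤ N, 0 ≤ Lχ a) (hS0 : ∀ a ≤ N, 0 ≤ S a) (hc₁ : 0 ≤ c₁) (hϑ0 : 0 < ϑ) (hϑ1 : ϑ < 1)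
    (hA0 : ∀ K t, |t| ≤ l₀ → ∀ τ ∈ T K, 0 ≤ shA K t τ) (hAle : ∀ K t, |t| ≤ l₀ → ∀ τ ∈ T K, shA K t τ ≤ A K t τ)
    (hAu : ∀ K t, |t| ≤ l₀ → ∀ τ ∈ T K,
      shA K t τ ≤ ∑ σ ∈ (range (N + 1)).sigma (fun a => range (n a)), shAs σ K t τ)
    (hB0 : ∀ K t, |t| ≤ l₀ → ∀ τ ∈ T K, 0 ≤ shB K t τ) (hBle : ∀ K t, |t| ≤ l₀ → ∀ τ ∈ T K, shB K t τ ≤ B K t τ)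
    (hBu : ∀ K t, |t| ≤ l₀ → ∀ τ ∈ T K,
      shB K t τ ≤ ∑ σ ∈ (range (N + 1)).sigma (fun a => range (n a)), shBs σ K t τ) :
    ShellWeightBound l₀ T A B shA shB
      fun K => (∑ a ∈ range (N + 1), (n a : ℝ) * (Lχ a * S a * c₁ * ϑ⁻¹ ^ a)) * ϑ ^ K :=
  shellWeightBound_of_le_geometric
    (shellWeightBound_of_lipProfile hLA hLB hSA hSB hL0 hS0 (fun j => mul_nonneg hc₁ (pow_nonneg hϑ0.le j))
      ((summable_geometric_of_lt_one hϑ0.le hϑ1).mul_left c₁) hA0 hAle hAu hB0 hBle hBu)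
    hϑ0.le hϑ1 (bandWeight_le_geometric hL0 hS0 hc₁ hϑ0)

/-- **ROAD II CLOSED FROM THE WIDTH.**  The (η) data with the Lipschitz constant absorbed into a suppression exponent,
`L_a·S_a ≤ e^{−p a}`, ARE road II's package: two `AgeLedger`s (`ageLedger_of_lipSlotLedger`) and THE level gain
`LevelGain N (lipWeight Lχ S ρ) p ρ` (`T4LipschitzCutoff.levelGain_of_lipWeight`: the missing inequality of `T4ShellCount`, met with
`y = ρ`) — so file 1's ROAD-II knit `n21_knit_ages` FIRES, weight `K ↦ Σ_{a≤N} n_a·(e^{−p a}·ρ(K − a))`.  No anti-concentration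
anywhere. [folklore] -/
theorem n21_knit_ages_of_lipProfile (hLA : LipSlotLedger l₀ T A N n shAs sibAs Lχ ρ)
    (hLB : LipSlotLedger l₀ T B N n shBs sibBs Lχ ρ)
    (hSA : SiblingSuppression l₀ T A N n sibAs S) (hSB : SiblingSuppression l₀ T B N n sibBs S)
    (hL0 : ∀ a ≤ N, 0 ≤ Lχ a) (hS0 : ∀ a ≤ N, 0 ≤ S a) (hρ0 : ∀ j, 0 ≤ ρ j) (hρ : Summable ρ)
    (hp : ∀ a ≤ N, Lχ a * S a ≤ Real.exp (-p a))
    (hA0 : ∀ K t, |t| ≤ l₀ → ∀ τ ∈ T K, 0 ≤ shA K t τ) (hAle : ∀ K t, |t| ≤ l₀ → ∀ τ ∈ T K, shA K t τ ≤ A K t τ)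
    (hAu : ∀ K t, |t| ≤ l₀ → ∀ τ ∈ T K,
      shA K t τ ≤ ∑ σ ∈ (range (N + 1)).sigma (fun a => range (n a)), shAs σ K t τ)
    (hB0 : ∀ K t, |t| ≤ l₀ → ∀ τ ∈ T K, 0 ≤ shB K t τ) (hBle : ∀ K t, |t| ≤ l₀ → ∀ τ ∈ T K, shB K t τ ≤ B K t τ)
    (hBu : ∀ K t, |t| ≤ l₀ → ∀ τ ∈ T K,
      shB K t τ ≤ ∑ σ ∈ (range (N + 1)).sigma (fun a => range (n a)), shBs σ K t τ) :
    ShellWeightBound l₀ T A B shA shB fun K => ∑ a ∈ range (N + 1), (n a : ℝ) * (Real.exp (-p a) * ρ (K - a)) :=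
  n21_knit_ages (ageLedger_of_lipSlotLedger hLA hSA hL0 hρ0) (ageLedger_of_lipSlotLedger hLB hSB hL0 hρ0)
    hA0 hAle hAu hB0 hBle hBu (levelGain_of_lipWeight hL0 hS0 hρ0 hρ hp)

end Explicit

/-! ## §2 At the spine carriers: `S_N21 SRec` for every profiled reading -/

section AtCarriers

variable {N : ℕ} [NeZero N]

/-- **`S_N21` FOR EVERY PROFILED (design (η)) READING.**  If the carrier predicate `SRec` hands, with every carrier bundle `S` it pins,
the (η) package — a window `Nw`, slot counts `n`, the two runs' min-pieces and siblings `shAs, sibAs, shBs, sibBs`, Lipschitz constants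
`Lχ`, a width `ρ`, sibling constants `Ssup` with: the two `LipSlotLedger`s at `(S.l₀, S.T, S.A)`, `(S.l₀, S.T, S.B)`, `SiblingSuppression`
in both runs, `0 ≤ Lχ`, `0 ≤ Ssup` on the window, `0 ≤ ρ` SUMMABLE, the shell parts `0 ≤ S.shA ≤ S.A`, `0 ≤ S.shB ≤ S.B` covered by the slot
pieces, and the record weight slot `S.Wsh` summable and `≥ Σ_{a≤Nw} n_a·lipWeight Lχ Ssup ρ a K` — then `S_N21 SRec` (§1's
`n21_knit_profiled`).  NO (M1), NO `D ≤ D̄`, NO live-window structure beyond the counts. [folklore] -/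
theorem s_N21_of_lipProfileReading (SRec : SpineRecordPred N)
    (hread : ∀ (F : T4Continuum.T4Family) (D : YMDAG.UVSplit.Datum F N) (g₀ : ℕ → ℝ)
      (os : List (T4Continuum.ULoop F)) (S : SpineCarriers), SRec F D g₀ os S →
      ∃ (Nw : ℕ) (n : ℕ → ℕ) (shAs sibAs shBs sibBs : (Σ _ : ℕ, ℕ) → ℕ → ℝ → S.ι → ℝ) (Lχ ρ Ssup : ℕ → ℝ),
        LipSlotLedger S.l₀ S.T S.A Nw n shAs sibAs Lχ ρ ∧ LipSlotLedger S.l₀ S.T S.B Nw n shBs sibBs Lχ ρ ∧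
        SiblingSuppression S.l₀ S.T S.A Nw n sibAs Ssup ∧ SiblingSuppression S.l₀ S.T S.B Nw n sibBs Ssup ∧
        (∀ a ≤ Nw, 0 ≤ Lχ a) ∧ (∀ a ≤ Nw, 0 ≤ Ssup a) ∧ (∀ j, 0 ≤ ρ j) ∧ Summable ρ ∧
        (∀ K t, |t| ≤ S.l₀ → ∀ τ ∈ S.T K, 0 ≤ S.shA K t τ) ∧ (∀ K t, |t| ≤ S.l₀ → ∀ τ ∈ S.T K, S.shA K t τ ≤ S.A K t τ) ∧
        (∀ K t, |t| ≤ S.l₀ → ∀ τ ∈ S.T K,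
          S.shA K t τ ≤ ∑ σ ∈ (range (Nw + 1)).sigma (fun a => range (n a)), shAs σ K t τ) ∧
        (∀ K t, |t| ≤ S.l₀ → ∀ τ ∈ S.T K, 0 ≤ S.shB K t τ) ∧ (∀ K t, |t| ≤ S.l₀ → ∀ τ ∈ S.T K, S.shB K t τ ≤ S.B K t τ) ∧
        (∀ K t, |t| ≤ S.l₀ → ∀ τ ∈ S.T K,
          S.shB K t τ ≤ ∑ σ ∈ (range (Nw + 1)).sigma (fun a => range (n a)), shBs σ K t τ) ∧
        (∀ K, ∑ a ∈ range (Nw + 1), (n a : ℝ) * lipWeight Lχ Ssup ρ a K ≤ S.Wsh K) ∧ Summable S.Wsh) :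
    S_N21 SRec := by
  intro F D g₀ os S hS
  obtain ⟨Nw, n, shAs, sibAs, shBs, sibBs, Lχ, ρ, Ssup, hLA, hLB, hSA, hSB, hL0, hS0, hρ0, hρ, hA0, hAle, hAu, hB0, hBle,
    hBu, hWsh, hsum⟩ := hread F D g₀ os S hS
  exact n21_knit_profiled hLA hLB hSA hSB hL0 hS0 hρ0 hρ hA0 hAle hAu hB0 hBle hBu hWsh hsum

/-- **THE SAME CONCLUSION THROUGH ROAD II's K5 THEOREM.**  If `SRec` hands the (η) package with the Lipschitz constants absorbed
(`L_a·Ssup_a ≤ e^{−p a}`) and a record weight dominating ROAD II's weight `Σ_{a≤Nw} n_a·(e^{−p a}·ρ(K − a))`, then `S_N21 SRec` by file 8's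
`s_N21_of_agesReading` — its road-II package (two `AgeLedger`s, `LevelGain Nw (lipWeight Lχ Ssup ρ) p ρ`) being MANUFACTURED from the (η)
data (`ageLedger_of_lipSlotLedger`, `T4LipschitzCutoff.levelGain_of_lipWeight`): FAN-OUT v1.1 §N21 s3's «N21 closes on road II» with the
level gain = the two-run width. [folklore] -/
theorem s_N21_of_lipProfileReading_viaRoadII (SRec : SpineRecordPred N)
    (hread : ∀ (F : T4Continuum.T4Family) (D : YMDAG.UVSplit.Datum F N) (g₀ : ℕ → ℝ)
      (os : List (T4Continuum.ULoop F)) (S : SpineCarriers), SRec F D g₀ os S →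
      ∃ (Nw : ℕ) (n : ℕ → ℕ) (shAs sibAs shBs sibBs : (Σ _ : ℕ, ℕ) → ℕ → ℝ → S.ι → ℝ) (Lχ ρ Ssup p : ℕ → ℝ),
        LipSlotLedger S.l₀ S.T S.A Nw n shAs sibAs Lχ ρ ∧ LipSlotLedger S.l₀ S.T S.B Nw n shBs sibBs Lχ ρ ∧
        SiblingSuppression S.l₀ S.T S.A Nw n sibAs Ssup ∧ SiblingSuppression S.l₀ S.T S.B Nw n sibBs Ssup ∧
        (∀ a ≤ Nw, 0 ≤ Lχ a) ∧ (∀ a ≤ Nw, 0 ≤ Ssup a) ∧ (∀ j, 0 ≤ ρ j) ∧ Summable ρ ∧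
        (∀ a ≤ Nw, Lχ a * Ssup a ≤ Real.exp (-p a)) ∧
        (∀ K t, |t| ≤ S.l₀ → ∀ τ ∈ S.T K, 0 ≤ S.shA K t τ) ∧ (∀ K t, |t| ≤ S.l₀ → ∀ τ ∈ S.T K, S.shA K t τ ≤ S.A K t τ) ∧
        (∀ K t, |t| ≤ S.l₀ → ∀ τ ∈ S.T K,
          S.shA K t τ ≤ ∑ σ ∈ (range (Nw + 1)).sigma (fun a => range (n a)), shAs σ K t τ) ∧
        (∀ K t, |t| ≤ S.l₀ → ∀ τ ∈ S.T K, 0 ≤ S.shB K t τ) ∧ (∀ K t, |t| ≤ S.l₀ → ∀ τ ∈ S.T K, S.shB K t τ ≤ S.B K t τ) ∧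
        (∀ K t, |t| ≤ S.l₀ → ∀ τ ∈ S.T K,
          S.shB K t τ ≤ ∑ σ ∈ (range (Nw + 1)).sigma (fun a => range (n a)), shBs σ K t τ) ∧
        (∀ K, ∑ a ∈ range (Nw + 1), (n a : ℝ) * (Real.exp (-p a) * ρ (K - a)) ≤ S.Wsh K) ∧ Summable S.Wsh) :
    S_N21 SRec := by
  refine s_N21_of_agesReading SRec fun F D g₀ os S hS => ?_
  obtain ⟨Nw, n, shAs, sibAs, shBs, sibBs, Lχ, ρ, Ssup, p, hLA, hLB, hSA, hSB, hL0, hS0, hρ0, hρ, hp, hA0, hAle, hAu, hB0,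
    hBle, hBu, hWsh, hsum⟩ := hread F D g₀ os S hS
  exact ⟨Nw, n, shAs, shBs, lipWeight Lχ Ssup ρ, p, ρ, ageLedger_of_lipSlotLedger hLA hSA hL0 hρ0,
    ageLedger_of_lipSlotLedger hLB hSB hL0 hρ0, hA0, hAle, hAu, hB0, hBle, hBu, levelGain_of_lipWeight hL0 hS0 hρ0 hρ hp,
    hWsh, hsum⟩

end AtCarriers

/-! ## §3 The width of record: N16's family `ρ_j = c₁·θ^j`, `θ⁶ = L⁻¹` (file 3 §4 BY NAME) -/

section N16Width

variable {N : ℕ} [NeZero N]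

/-- **`S_N21` FOR THE PROFILED READING AT N16's WIDTH.**  As §2 with the width FIXED to node N16's family `ρ_j = c₁·θ^j`
(`…N21ClosenessJunction.relWidth_of_n16`: `c₁ = C_Q∕ε`; at run B's own fine test `…N21FineTestJunction.relWidth_fineTest_of_n16`:
`c₁ = (C_Q + K)∕ε` under `RegularSup`), `θ⁶ = L⁻¹`, `2 ≤ L`, `0 < θ`, `0 ≤ c₁`: the sign and SUMMABILITY clauses of §2 are DISCHARGED by
file 3's `theta_lt_one` ∕ `summable_width` — what the record predicate still hands is [dict]+(η), the sibling suppression and the weight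
slot. [folklore] -/
theorem s_N21_of_lipProfileReading_n16Width (SRec : SpineRecordPred N)
    (hread : ∀ (F : T4Continuum.T4Family) (D : YMDAG.UVSplit.Datum F N) (g₀ : ℕ → ℝ)
      (os : List (T4Continuum.ULoop F)) (S : SpineCarriers), SRec F D g₀ os S →
      ∃ (Nw : ℕ) (n : ℕ → ℕ) (shAs sibAs shBs sibBs : (Σ _ : ℕ, ℕ) → ℕ → ℝ → S.ι → ℝ) (Lχ Ssup : ℕ → ℝ) (L : ℕ)
        (θ c₁ : ℝ),
        2 ≤ L ∧ 0 < θ ∧ θ ^ 6 = ((L : ℝ))⁻¹ ∧ 0 ≤ c₁ ∧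
        LipSlotLedger S.l₀ S.T S.A Nw n shAs sibAs Lχ (fun j => c₁ * θ ^ j) ∧
        LipSlotLedger S.l₀ S.T S.B Nw n shBs sibBs Lχ (fun j => c₁ * θ ^ j) ∧
        SiblingSuppression S.l₀ S.T S.A Nw n sibAs Ssup ∧ SiblingSuppression S.l₀ S.T S.B Nw n sibBs Ssup ∧
        (∀ a ≤ Nw, 0 ≤ Lχ a) ∧ (∀ a ≤ Nw, 0 ≤ Ssup a) ∧
        (∀ K t, |t| ≤ S.l₀ → ∀ τ ∈ S.T K, 0 ≤ S.shA K t τ) ∧ (∀ K t, |t| ≤ S.l₀ → ∀ τ ∈ S.T K, S.shA K t τ ≤ S.A K t τ) ∧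
        (∀ K t, |t| ≤ S.l₀ → ∀ τ ∈ S.T K,
          S.shA K t τ ≤ ∑ σ ∈ (range (Nw + 1)).sigma (fun a => range (n a)), shAs σ K t τ) ∧
        (∀ K t, |t| ≤ S.l₀ → ∀ τ ∈ S.T K, 0 ≤ S.shB K t τ) ∧ (∀ K t, |t| ≤ S.l₀ → ∀ τ ∈ S.T K, S.shB K t τ ≤ S.B K t τ) ∧
        (∀ K t, |t| ≤ S.l₀ → ∀ τ ∈ S.T K,
          S.shB K t τ ≤ ∑ σ ∈ (range (Nw + 1)).sigma (fun a => range (n a)), shBs σ K t τ) ∧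
        (∀ K, ∑ a ∈ range (Nw + 1), (n a : ℝ) * lipWeight Lχ Ssup (fun j => c₁ * θ ^ j) a K ≤ S.Wsh K) ∧ Summable S.Wsh) :
    S_N21 SRec := by
  intro F D g₀ os S hS
  obtain ⟨Nw, n, shAs, sibAs, shBs, sibBs, Lχ, Ssup, L, θ, c₁, hL2, hθ, hθ6, hc₁, hLA, hLB, hSA, hSB, hL0, hS0, hA0, hAle, hAu,
    hB0, hBle, hBu, hWsh, hsum⟩ := hread F D g₀ os S hS
  exact n21_knit_profiled hLA hLB hSA hSB hL0 hS0 (fun j => mul_nonneg hc₁ (pow_nonneg hθ.le j))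
    (summable_width hL2 hθ hθ6 c₁) hA0 hAle hAu hB0 hBle hBu hWsh hsum

/-- **THE PRICE AT N16's WIDTH, CLOSED FORM.**  `Σ_K Σ_{a≤N} n_a·lipWeight Lχ S (c₁θ^·) a K = C0(n, L·S)·(c₁·(1 − θ)⁻¹)`
(`T4LipschitzCutoff.tsum_weight_eq` — cube count × Lipschitz constant × sibling suppression summed over the window ONCE — times the
geometric total of the width; `θ < 1` by file 3's `theta_lt_one`). [folklore] -/
theorem tsum_bandWeight_n16Width {Nw : ℕ} (n : ℕ → ℕ) (Lχ Ssup : ℕ → ℝ) {L : ℕ} (hL2 : 2 ≤ L) {θ : ℝ} (hθ : 0 < θ)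
    (hθ6 : θ ^ 6 = ((L : ℝ))⁻¹) (c₁ : ℝ) :
    ∑' K, (∑ a ∈ range (Nw + 1), (n a : ℝ) * lipWeight Lχ Ssup (fun j => c₁ * θ ^ j) a K) =
      C0 Nw (fun a => (n a : ℝ)) (fun a => Lχ a * Ssup a) * (c₁ * (1 - θ)⁻¹) := by
  rw [tsum_weight_eq n Lχ Ssup (summable_width hL2 hθ hθ6 c₁), tsum_mul_left,
    tsum_geometric_of_lt_one hθ.le (theta_lt_one hL2 hθ6)]

end N16Width

/-! ## §4 Vacuity guard: the profiled reading is INHABITED non-degenerately and `S_N21` FIRES on it -/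

section NonVacuity

open T4ShellMeasureLevels.Toy (T A sh)

/-- **THE ONE-SLOT PROFILED TOY.**  Carriers of `T4ShellMeasureLevels.Toy` (one term `()` of unit weight per run and step, shell part
`ϑ^K`); window `N = 0`, one slot of age `0` (`n ≡ 1`), min-piece `ϑ^K`, sibling `1`, Lipschitz constant `1`, width `ρ_j = ϑ^j`: for
`0 ≤ ϑ ≤ 1` this is a `LipSlotLedger` (the band inequality `ϑ^K ≤ 1·ϑ^{K−0}·1` with equality). [folklore] -/
theorem lipSlotLedger_toy (l₀ : ℝ) {ϑ : ℝ} (h0 : 0 ≤ ϑ) (h1 : ϑ ≤ 1) :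
    LipSlotLedger l₀ T A 0 (fun _ => 1) (fun _ K _ _ => ϑ ^ K) (fun _ _ _ _ => (1 : ℝ)) (fun _ => 1) (fun j => ϑ ^ j) where
  piece_nonneg _ _ K _ _ _ _ := pow_nonneg h0 K
  piece_le _ _ K _ _ _ _ := by simpa [A] using pow_le_one₀ h0 h1 (n := K)
  piece_offband σ hσ K _ _ hK _ _ := by
    have : σ.1 = 0 := by simpa using (mem_sigma.1 hσ).1
    omega
  sib_nonneg _ _ _ _ _ _ _ := zero_le_one
  piece_le_sib σ hσ K _ _ _ _ _ := by
    have : σ.1 = 0 := by simpa using (mem_sigma.1 hσ).1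
    rw [this]
    simp

/-- … with sibling suppression `S ≡ 1` (the sibling IS the term). [folklore] -/
theorem siblingSuppression_toy (l₀ : ℝ) :
    SiblingSuppression l₀ T A 0 (fun _ => 1) (fun _ _ _ _ => (1 : ℝ)) fun _ => 1 := by
  intro σ _ K t _
  simp [T, A]

/-- The toy's band weight at step `K` is exactly `ϑ^K`. [folklore] -/
theorem toy_bandWeight_eq (ϑ : ℝ) (K : ℕ) :
    ∑ a ∈ range (0 + 1), (((fun _ => 1 : ℕ → ℕ) a : ℕ) : ℝ) * lipWeight (fun _ => (1 : ℝ)) (fun _ => 1) (fun j => ϑ ^ j) a K =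
      ϑ ^ K := by
  simp [lipWeight]

/-- **THE PROFILED READING IS INHABITED AND `S_N21` FIRES ON IT.**  For `0 < ϑ < 1` there is a carrier predicate `SRec` over `SU(2)`
data such that (i) `SRec` is a PROFILED READING predicate — every bundle it pins carries EXACTLY the package of §2's
`s_N21_of_lipProfileReading`; (ii) it is INHABITED: some family, datum, bare sequence, string and bundle satisfy it, the bundle having
nonempty classes, positive weights, positive shell parts and positive record weight `S.Wsh K = ϑ^K` at every step; (iii) `S_N21 SRec`
holds (by §2).  So §2's binder is not void and its conclusion is not the empty implication (audit A1–A6).  A toy, NOT Bałaban's terms.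
[folklore] -/
theorem s_N21_fires_on_lipProfileReading (l₀ : ℝ) {ϑ : ℝ} (h0 : 0 < ϑ) (h1 : ϑ < 1) :
    ∃ SRec : SpineRecordPred 2,
      (∀ (F : T4Continuum.T4Family) (D : YMDAG.UVSplit.Datum F 2) (g₀ : ℕ → ℝ) (os : List (T4Continuum.ULoop F))
          (S : SpineCarriers), SRec F D g₀ os S →
        ∃ (Nw : ℕ) (n : ℕ → ℕ) (shAs sibAs shBs sibBs : (Σ _ : ℕ, ℕ) → ℕ → ℝ → S.ι → ℝ) (Lχ ρ Ssup : ℕ → ℝ),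
          LipSlotLedger S.l₀ S.T S.A Nw n shAs sibAs Lχ ρ ∧ LipSlotLedger S.l₀ S.T S.B Nw n shBs sibBs Lχ ρ ∧
          SiblingSuppression S.l₀ S.T S.A Nw n sibAs Ssup ∧ SiblingSuppression S.l₀ S.T S.B Nw n sibBs Ssup ∧
          (∀ a ≤ Nw, 0 ≤ Lχ a) ∧ (∀ a ≤ Nw, 0 ≤ Ssup a) ∧ (∀ j, 0 ≤ ρ j) ∧ Summable ρ ∧
          (∀ K t, |t| ≤ S.l₀ → ∀ τ ∈ S.T K, 0 ≤ S.shA K t τ) ∧ (∀ K t, |t| ≤ S.l₀ → ∀ τ ∈ S.T K, S.shA K t τ ≤ S.A K t τ) ∧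
          (∀ K t, |t| ≤ S.l₀ → ∀ τ ∈ S.T K,
            S.shA K t τ ≤ ∑ σ ∈ (range (Nw + 1)).sigma (fun a => range (n a)), shAs σ K t τ) ∧
          (∀ K t, |t| ≤ S.l₀ → ∀ τ ∈ S.T K, 0 ≤ S.shB K t τ) ∧ (∀ K t, |t| ≤ S.l₀ → ∀ τ ∈ S.T K, S.shB K t τ ≤ S.B K t τ) ∧
          (∀ K t, |t| ≤ S.l₀ → ∀ τ ∈ S.T K,
            S.shB K t τ ≤ ∑ σ ∈ (range (Nw + 1)).sigma (fun a => range (n a)), shBs σ K t τ) ∧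
          (∀ K, ∑ a ∈ range (Nw + 1), (n a : ℝ) * lipWeight Lχ Ssup ρ a K ≤ S.Wsh K) ∧ Summable S.Wsh) ∧
      (∃ (F : T4Continuum.T4Family) (D : YMDAG.UVSplit.Datum F 2) (g₀ : ℕ → ℝ) (os : List (T4Continuum.ULoop F))
          (S : SpineCarriers), SRec F D g₀ os S ∧ (∀ K, (S.T K).Nonempty) ∧
          (∀ K t τ, 0 < S.A K t τ ∧ 0 < S.B K t τ ∧ 0 < S.shA K t τ ∧ 0 < S.shB K t τ) ∧ ∀ K, 0 < S.Wsh K) ∧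
      S_N21 SRec := by
  obtain ⟨F, ⟨Dat⟩⟩ := N21AtSpineCarriers.exists_family_and_datum
  have hL : LipSlotLedger l₀ T A 0 (fun _ => 1) (fun _ K _ _ => ϑ ^ K) (fun _ _ _ _ => (1 : ℝ)) (fun _ => 1)
      (fun j => ϑ ^ j) := lipSlotLedger_toy l₀ h0.le h1.le
  have hS : SiblingSuppression l₀ T A 0 (fun _ => 1) (fun _ _ _ _ => (1 : ℝ)) fun _ => 1 := siblingSuppression_toy l₀
  have hsum : Summable fun K : ℕ => ϑ ^ K := summable_geometric_of_lt_one h0.le h1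
  have hu : ∀ (K : ℕ) (t : ℝ), |t| ≤ l₀ → ∀ τ ∈ T K,
      sh ϑ K t τ ≤ ∑ σ ∈ (range (0 + 1)).sigma (fun a => range ((fun _ : ℕ => 1) a)),
        (fun (_ : Σ _ : ℕ, ℕ) (K : ℕ) (_ : ℝ) (_ : Unit) => ϑ ^ K) σ K t τ := by
    intro K t _ τ _
    simp [sh]
  refine ⟨_, fun _ _ _ _ _ h => h, ?_, s_N21_of_lipProfileReading _ fun _ _ _ _ _ h => h⟩
  refine ⟨F, Dat, fun _ => 0, [],
    { ι := Unit, l₀ := l₀, vol := 1, K₀ := 0, T := T, A := A, B := A, shA := sh ϑ, shB := sh ϑ, Bad := fun _ _ => ∅,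
      W := fun _ => 0, Wsh := fun K => ϑ ^ K, δ := fun _ => 0 }, ?_, ?_, ?_, ?_⟩
  · refine ⟨0, fun _ => 1, fun _ K _ _ => ϑ ^ K, fun _ _ _ _ => 1, fun _ K _ _ => ϑ ^ K, fun _ _ _ _ => 1, fun _ => 1,
      fun j => ϑ ^ j, fun _ => 1, hL, hL, hS, hS, fun _ _ => zero_le_one, fun _ _ => zero_le_one, fun j => pow_nonneg h0.le j,
      hsum, fun K _ _ _ _ => pow_nonneg h0.le K, fun K _ _ _ _ => ?_, hu, fun K _ _ _ _ => pow_nonneg h0.le K,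
      fun K _ _ _ _ => ?_, hu, fun K => (toy_bandWeight_eq ϑ K).le, hsum⟩
    · simpa [sh, A] using pow_le_one₀ h0.le h1.le (n := K)
    · simpa [sh, A] using pow_le_one₀ h0.le h1.le (n := K)
  · intro K; exact ⟨(), by simp [T]⟩
  · intro K t τ
    exact ⟨by simp [A], by simp [A], by simpa [sh] using pow_pos h0 K, by simpa [sh] using pow_pos h0 K⟩
  · intro K; exact pow_pos h0 K

end NonVacuity

end Summit.QuantumFields.YangMills.Theorems.N21AtSpineCarriersProfiled

end
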